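import Summits.QuantumFields.YangMills.Theorems.FlatTubeReductionFibredBOCross
import HarnessLib

/-!
# Fibred Born–Oppenheimer blocks — part 5: the fibred adiabatic projection `PΦ = (∫Φ_cΩ_c dπ)·Ω_c` and its complement
# (route `FlatTubeReduction`, crux K1 `NearFlatRatioLaw` stmt-QuantumFields-24720, registered stub `stub_boRate` = FCL 23943's `BORateAll`;
# rung R2b1 = RECORD-label femto gap; no summit statement is proved here)

Seat `ym-line-ftr-p1` g6 (prover).  Parts 1–4 prove the blocks for a product state `f⊗Ω` against a fibrewise-orthogonal `χ`.  This file fixes the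
ADIABATIC SPLIT of an arbitrary state `Φ` on `X = C × Q` along a `c`-DEPENDENT normalised fibre profile `Ω_c` (route RED lane A's `boProj`/`boOrth` of
`…InnerModelBlocks` is the `c`-independent Hermite case):
* `fibredCoeff`, `fibredProj`, `fibredOrth` — `f(c) = ∫ Φ(c,q)Ω_c(q)dπ`, `(PΦ)(c,q) = f(c)Ω_c(q)`, `χ = Φ − PΦ`;
* ★ `integral_profile_mul_fibredOrth` — every fibre of `χ` is `L²(π)`-orthogonal to `Ω_c` (`∫Ω_c² dπ = 1`);
* ★ `integral_fibredProj_mul_fibredOrth` — hence `⟨PΦ, χ⟩_{L²(ν⊗π)} = 0` EXACTLY ((P1) of the door with tolerance `0` for a product a-priori measure);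
* `integral_fibredProj_sq` — `‖PΦ‖² = ∫ f² dν`;
* ★ `fibrePair_profile_fibredOrth_eq_zero` — if `Ω_c` is `K_c`-symmetric-orthogonal to its `L²`-complement (the frozen eigen-equation, hypothesis `heig`), then
  `B_{c,c}(Ω_c, χ_c) = 0` — the hypothesis `horth` of the CROSS block `sq_fibredForm_prod_le_of_orth`;
so the door's (P1)(P3)(P4)(P5) for `Φ = PΦ + χ` are `integral_fibredProj_mul_fibredOrth`, `fibredForm_le_of_fibreGap` (on `χ`), `sq_fibredForm_prod_le_of_orth`
and `fibredForm_prod_le` (on `f = fibredCoeff`).  HONEST FRAMING: bookkeeping for the registered stub of a crux of the CONDITIONAL reduction route to the femto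
rung R2b1 (RECORD label); the chart and the frozen fibre ground states are OPEN (route RED lane A C4-CORE + the rate twin); nothing here is infinite volume, a
continuum limit or the Clay mass gap.  No named facts, no `sorry`.

## References
* S. J. Gustafson, I. M. Sigal, *Mathematical Concepts of Quantum Mechanics*, Springer 2003, §12 (Born–Oppenheimer, adiabatic projection) — [cite: GustafsonSigal2003, §12].
-/

set_option autoImplicit false

noncomputable section

open MeasureTheory

namespace Summit.QuantumFields.YangMills.Theorems.FemtoTransferGap.FibredBO

variable {C Q Z : Type*} [MeasurableSpace C] [MeasurableSpace Q] [MeasurableSpace Z]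

section Defs

variable (π : Measure Q) (Ω : C → Q → ℝ)

/-- Slow coefficient of `Φ` along the fibre profile: `f(c) = ∫ Φ(c,q)·Ω_c(q) dπ(q)`. -/
def fibredCoeff (Φ : C × Q → ℝ) (c : C) : ℝ := ∫ q, Φ (c, q) * Ω c q ∂π

/-- The fibred adiabatic projection: `(PΦ)(c,q) = f(c)·Ω_c(q)`. -/
def fibredProj (Φ : C × Q → ℝ) : C × Q → ℝ := fun x => fibredCoeff π Ω Φ x.1 * Ω x.1 x.2

/-- Its complement: `χ = Φ − PΦ`. -/
def fibredOrth (Φ : C × Q → ℝ) : C × Q → ℝ := fun x => Φ x - fibredProj π Ω Φ x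

end Defs

variable {ν : Measure C} {π : Measure Q} {ρ : Measure Z} [SFinite ν] [SFinite π]
variable {s : C → Q → Z → ℝ} {Ω : C → Q → ℝ}

omit [MeasurableSpace C] [MeasurableSpace Z] [SFinite π] in
/-- `Φ = PΦ + χ` pointwise. [folklore] -/
theorem fibredProj_add_fibredOrth (Φ : C × Q → ℝ) (x : C × Q) : fibredProj π Ω Φ x + fibredOrth π Ω Φ x = Φ x := by
  unfold fibredOrth
  ring

omit [MeasurableSpace C] [MeasurableSpace Z] [SFinite π] in
/-- ★ **Fibrewise orthogonality of the complement**: if `∫ Ω_c² dπ = 1` (and `Φ_cΩ_c`, `Ω_c²` are integrable) then `∫ Ω_c(q)·χ(c,q) dπ = 0`.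
[cite: GustafsonSigal2003, §12] -/
theorem integral_profile_mul_fibredOrth (Φ : C × Q → ℝ) (c : C) (hΩ1 : ∫ q, Ω c q ^ 2 ∂π = 1)
    (hΦΩ : Integrable (fun q => Φ (c, q) * Ω c q) π) (hΩ2 : Integrable (fun q => Ω c q ^ 2) π) :
    ∫ q, Ω c q * fibredOrth π Ω Φ (c, q) ∂π = 0 := by
  have e : (fun q => Ω c q * fibredOrth π Ω Φ (c, q)) = fun q => Φ (c, q) * Ω c q - fibredCoeff π Ω Φ c * Ω c q ^ 2 := by
    funext q
    unfold fibredOrth fibredProj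
    ring
  rw [e, integral_sub hΦΩ (hΩ2.const_mul _), integral_const_mul, hΩ1, mul_one]
  unfold fibredCoeff
  ring

omit [MeasurableSpace Z] in
/-- ★ **(P1) exactly**: `⟨PΦ, χ⟩_{L²(ν⊗π)} = 0` for the product a-priori measure. [cite: GustafsonSigal2003, §12] -/
theorem integral_fibredProj_mul_fibredOrth (Φ : C × Q → ℝ) (hΩ1 : ∀ c, ∫ q, Ω c q ^ 2 ∂π = 1)
    (hΦΩ : ∀ c, Integrable (fun q => Φ (c, q) * Ω c q) π) (hΩ2 : ∀ c, Integrable (fun q => Ω c q ^ 2) π)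
    (hI : Integrable (fun x : C × Q => fibredCoeff π Ω Φ x.1 * Ω x.1 x.2 * fibredOrth π Ω Φ x) (ν.prod π)) :
    ∫ x, fibredProj π Ω Φ x * fibredOrth π Ω Φ x ∂(ν.prod π) = 0 :=
  integral_prod_mul_eq_zero_of_fibre_orth (fibredCoeff π Ω Φ) Ω (fibredOrth π Ω Φ) hI
    fun c => integral_profile_mul_fibredOrth Φ c (hΩ1 c) (hΦΩ c) (hΩ2 c)

omit [MeasurableSpace Z] in
/-- `‖PΦ‖²_{L²(ν⊗π)} = ∫ f² dν` for a normalised profile. [folklore] -/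
theorem integral_fibredProj_sq (Φ : C × Q → ℝ) (hΩ1 : ∀ c, ∫ q, Ω c q ^ 2 ∂π = 1)
    (hI : Integrable (fun x : C × Q => fibredProj π Ω Φ x ^ 2) (ν.prod π)) :
    ∫ x, fibredProj π Ω Φ x ^ 2 ∂(ν.prod π) = ∫ c, fibredCoeff π Ω Φ c ^ 2 ∂ν := by
  rw [integral_prod _ hI]
  refine integral_congr_ae (ae_of_all _ fun c => ?_)
  have e : (fun q => fibredProj π Ω Φ (c, q) ^ 2) = fun q => fibredCoeff π Ω Φ c ^ 2 * Ω c q ^ 2 := by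
    funext q
    unfold fibredProj
    ring
  show ∫ q, fibredProj π Ω Φ (c, q) ^ 2 ∂π = fibredCoeff π Ω Φ c ^ 2
  rw [e, integral_const_mul, hΩ1 c, mul_one]

omit [MeasurableSpace C] [SFinite π] in
/-- ★ **`K_c`-orthogonality of the complement** (the hypothesis `horth` of the CROSS block): if the frozen fibre pairing of `Ω_c` against any fibre function
`L²(π)`-orthogonal to `Ω_c` vanishes — `heig`, which is the frozen eigen-equation `K_cΩ_c = λ(c)Ω_c` read weakly — then `B_{c,c}(Ω_c, χ(c,·)) = 0`.
[cite: GustafsonSigal2003, §12] -/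
theorem fibrePair_profile_fibredOrth_eq_zero (ρ : Measure Z) (s : C → Q → Z → ℝ) (Φ : C × Q → ℝ) (c : C) (hΩ1 : ∫ q, Ω c q ^ 2 ∂π = 1)
    (hΦΩ : Integrable (fun q => Φ (c, q) * Ω c q) π) (hΩ2 : Integrable (fun q => Ω c q ^ 2) π)
    (heig : ∀ h : Q → ℝ, ∫ q, Ω c q * h q ∂π = 0 → fibrePair π ρ s c c (Ω c) h = 0) :
    fibrePair π ρ s c c (Ω c) (fun q => fibredOrth π Ω Φ (c, q)) = 0 :=
  heig _ (integral_profile_mul_fibredOrth Φ c hΩ1 hΦΩ hΩ2)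

end Summit.QuantumFields.YangMills.Theorems.FemtoTransferGap.FibredBO

end
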